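import Summits.ValiantsHypothesis.ValiantsHypothesis.Theorems.SymPencilHomogeneousDrop

/-!
# Route `SymPencil` — the homogeneity drop, second rung: `rank A₀ ≤ 2` in the kernel-fixed case
# (core normal-form lemma for the crux `SdcPerBeyondN`, stmt-ValiantsHypothesis-5676)

Setting of `SymPencilHomogeneousDrop.lean`: `Y = A(x) ≅ 0 ⊕ Δ` in a basis through the kernel
vector `w`, the homogeneity identity
`det (0 ⊕ Δ + M v + ν A₀) = (1 + ν) ^ j · det (0 ⊕ Δ + M v)` for a linear family `M` of symmetric
matrices.  There the kernel-row map (first column of `M v`) was ONTO and the conclusion was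
`j = 0`.  Here (`rank_le_two_of_det_add_smul`) we assume instead

* `A₀ w = 0`, i.e. `A₀ ≅ 0 ⊕ E` (the kernel of `A(λ x)` does not move along the cone line), and
* the first-column map hits some corner-`1` column and, among the corner-`0` columns `(0, b)`,
  at least a hyperplane `{b : l ⬝ b = 0}`,

and conclude `rank E ≤ 2`: a generic `ν₀` and the directions `(1, b₁ + λ b)`, `λ ∈ {0, ±1}`, give
`bᵀ ((Δ + ν₀ E)⁻¹ - Δ⁻¹) b = 0` on the hyperplane, so `N := (Δ + ν₀ E)⁻¹ - Δ⁻¹` has rank `≤ 2`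
(`rank_le_two_of_quadratic_form_eq_zero_on_hyperplane`) and `ν₀ E = -Δ N (Δ + ν₀ E)`.

For the permanent this contradicts `rank A₀ = m - 1` (Alper–Bogart–Velasco regularity), see
`SymPencilSdcPerBeyondN.lean`. Elementary linear algebra throughout. [folklore]
-/

noncomputable section

-- single-conjunct layout: Sub = Summit, duplicated namespace component intended
set_option linter.dupNamespace false

namespace Summit.ValiantsHypothesis.ValiantsHypothesis.Theorems.SymPencilHomogeneousDropRankTwo

open Matrix Polynomial
open Summit.ValiantsHypothesis.ValiantsHypothesis.Theorems.SymPencilHomogeneousDropTools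

universe u

variable {k : Type u} [Field k]

/-! ### A symmetric form vanishing on a hyperplane has rank at most two -/

section RankTwo

variable {ι : Type*} [Fintype ι] [DecidableEq ι]

omit [Fintype ι] [DecidableEq ι] in
/-- `finrank (k ∙ v) ≤ 1`. [folklore] -/
theorem finrank_span_singleton_le_one (v : ι → k) :
    Module.finrank k (Submodule.span k ({v} : Set (ι → k))) ≤ 1 := by
  by_cases hv : v = 0
  · subst hv
    rw [Submodule.span_zero_singleton, finrank_bot]
    exact zero_le_one
  · rw [finrank_span_singleton hv]

/-- **A symmetric matrix whose quadratic form vanishes on the hyperplane `{b : l ⬝ b = 0}` has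
rank `≤ 2`** (`2 ≠ 0`): polarising, `N` kills the hyperplane in pairs, so `N b ∈ span {l, N z}`
for a fixed `z` with `l ⬝ z = 1`. (If `l = 0` then `N = 0`.) [folklore] -/
theorem rank_le_two_of_quadratic_form_eq_zero_on_hyperplane [NeZero (2 : k)] {N : Matrix ι ι k}
    (hN : Nᵀ = N) (l : ι → k) (h : ∀ b : ι → k, l ⬝ᵥ b = 0 → b ⬝ᵥ N *ᵥ b = 0) : N.rank ≤ 2 := by
  -- polarisation on the hyperplane
  have hsym : ∀ b c : ι → k, b ⬝ᵥ N *ᵥ c = c ⬝ᵥ N *ᵥ b := fun b c => by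
    rw [Matrix.dotProduct_mulVec, ← Matrix.mulVec_transpose, hN, dotProduct_comm]
  have hpol : ∀ b c : ι → k, l ⬝ᵥ b = 0 → l ⬝ᵥ c = 0 → b ⬝ᵥ N *ᵥ c = 0 := by
    intro b c hb hc
    have hbc := h (b + c) (by rw [dotProduct_add, hb, hc, add_zero])
    rw [Matrix.mulVec_add, dotProduct_add, add_dotProduct, add_dotProduct, h b hb, h c hc,
      hsym c b, zero_add, add_zero, ← two_mul] at hbc
    exact (mul_eq_zero.1 hbc).resolve_left (NeZero.ne 2)
  by_cases hl : l = 0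
  · have hN0 : N = 0 := eq_zero_of_quadratic_form_eq_zero hN fun b => h b (by rw [hl, zero_dotProduct])
    rw [hN0, Matrix.rank_zero]
    exact Nat.zero_le _
  obtain ⟨i₀, hi₀⟩ : ∃ i, l i ≠ 0 := Function.ne_iff.mp hl
  -- `z` with `l ⬝ z = 1`, and the projection `b ↦ b - (l ⬝ b) z` onto the hyperplane
  set z : ι → k := (l i₀)⁻¹ • Pi.single i₀ 1 with hz
  have hlz : l ⬝ᵥ z = 1 := by
    rw [hz, dotProduct_smul, dotProduct_single_one, smul_eq_mul, inv_mul_cancel₀ hi₀]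
  have hproj : ∀ b : ι → k, l ⬝ᵥ (b - (l ⬝ᵥ b) • z) = 0 := fun b => by
    rw [dotProduct_sub, dotProduct_smul, hlz, smul_eq_mul, mul_one, sub_self]
  -- `N (b - (l ⬝ b) z) = (z ⬝ N (b - (l ⬝ b) z)) • l`
  have hker : ∀ b : ι → k, l ⬝ᵥ b = 0 → N *ᵥ b = (z ⬝ᵥ N *ᵥ b) • l := by
    intro b hb
    have hc : ∀ c : ι → k, c ⬝ᵥ N *ᵥ b = c ⬝ᵥ ((z ⬝ᵥ N *ᵥ b) • l) := by
      intro c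
      have hsplit : c = (c - (l ⬝ᵥ c) • z) + (l ⬝ᵥ c) • z := by abel
      conv_lhs => rw [hsplit]
      rw [add_dotProduct, hpol _ _ (hproj c) hb, zero_add, smul_dotProduct, dotProduct_smul,
        smul_eq_mul, smul_eq_mul, dotProduct_comm c l, mul_comm]
    ext i
    simpa [single_one_dotProduct] using hc (Pi.single i 1)
  -- hence `range N ⊆ span {l, N z}`
  have hrange : LinearMap.range N.mulVecLin ≤
      Submodule.span k ({l} : Set (ι → k)) ⊔ Submodule.span k ({N *ᵥ z} : Set (ι → k)) := by
    rintro _ ⟨b, rfl⟩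
    rw [Matrix.mulVecLin_apply]
    have hsplit : N *ᵥ b = (z ⬝ᵥ N *ᵥ (b - (l ⬝ᵥ b) • z)) • l + (l ⬝ᵥ b) • (N *ᵥ z) := by
      rw [← hker _ (hproj b), Matrix.mulVec_sub, Matrix.mulVec_smul, sub_add_cancel]
    rw [hsplit]
    exact Submodule.add_mem_sup (Submodule.smul_mem _ _ (Submodule.subset_span rfl))
      (Submodule.smul_mem _ _ (Submodule.subset_span rfl))
  calc N.rank = Module.finrank k (LinearMap.range N.mulVecLin) := rfl
    _ ≤ Module.finrank k ↥(Submodule.span k ({l} : Set (ι → k)) ⊔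
          Submodule.span k ({N *ᵥ z} : Set (ι → k))) := Submodule.finrank_mono hrange
    _ ≤ Module.finrank k (Submodule.span k ({l} : Set (ι → k))) +
          Module.finrank k (Submodule.span k ({N *ᵥ z} : Set (ι → k))) :=
        Submodule.finrank_add_le_finrank_add_finrank _ _
    _ ≤ 1 + 1 := add_le_add (finrank_span_singleton_le_one _) (finrank_span_singleton_le_one _)

end RankTwo

/-! ### The core lemma, kernel-fixed case -/

section Core

variable [CharZero k] {ι' : Type*} [Fintype ι'] [DecidableEq ι']
  {V : Type*} [AddCommGroup V] [Module k V]

/-- **Homogeneity drop, kernel-fixed case.** Let `Δ` be invertible symmetric, `E` symmetric, `M`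
a linear family of symmetric matrices on `Unit ⊕ ι'` with
`det (0 ⊕ Δ + M v + ν (0 ⊕ E)) = (1 + ν) ^ j · det (0 ⊕ Δ + M v)` for all `v` and `ν ≠ -1`.  If some
`M v` has corner `1`, and every column `(0, b)` with `l ⬝ b = 0` is the first column of some
`M v`, then `rank E ≤ 2`. [folklore] -/
theorem rank_le_two_of_det_add_smul (Δ E : Matrix ι' ι' k) (hΔ : IsUnit Δ.det) (hΔs : Δᵀ = Δ)
    (hEs : Eᵀ = E) (j : ℕ) (M : V →ₗ[k] Matrix (Unit ⊕ ι') (Unit ⊕ ι') k)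
    (hMs : ∀ v, (M v)ᵀ = M v)
    (hH : ∀ (v : V) (ν : k), ν ≠ -1 →
      (Matrix.fromBlocks (0 : Matrix Unit Unit k) 0 0 Δ + M v +
          ν • Matrix.fromBlocks (0 : Matrix Unit Unit k) 0 0 E).det =
        (1 + ν) ^ j * (Matrix.fromBlocks (0 : Matrix Unit Unit k) 0 0 Δ + M v).det)
    (h1 : ∃ v, M v (Sum.inl ()) (Sum.inl ()) = 1) (l : ι' → k)
    (h0 : ∀ b : ι' → k, l ⬝ᵥ b = 0 →
      ∃ v, M v (Sum.inl ()) (Sum.inl ()) = 0 ∧ ∀ i, M v (Sum.inr i) (Sum.inl ()) = b i) :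
    E.rank ≤ 2 := by
  classical
  have hΔ0 : Δ.det ≠ 0 := hΔ.ne_zero
  -- `0 ⊕ E` in the block form of the tools file
  have hA₀ : Matrix.fromBlocks (0 : Matrix Unit Unit k) 0 0 E =
      Matrix.fromBlocks ((0 : k) • (1 : Matrix Unit Unit k)) (Matrix.replicateRow Unit (0 : ι' → k))
        (Matrix.replicateCol Unit (0 : ι' → k)) E := by
    ext (i | i) (j | j) <;> simp
  -- the identity along a direction with first column `(a, b)`, scaled by `ε`, at `ν`
  have hHdir : ∀ (v : V) (a : k) (b : ι' → k), M v (Sum.inl ()) (Sum.inl ()) = a →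
      (∀ i, M v (Sum.inr i) (Sum.inl ()) = b i) → ∀ (ε ν : k), ν ≠ -1 →
      (Matrix.fromBlocks ((ε * a) • (1 : Matrix Unit Unit k))
        (Matrix.replicateRow Unit (ε • b)) (Matrix.replicateCol Unit (ε • b))
        (Δ + ε • (M v).toBlocks₂₂ + ν • E)).det =
      (1 + ν) ^ j * (Matrix.fromBlocks ((ε * a) • (1 : Matrix Unit Unit k))
        (Matrix.replicateRow Unit (ε • b)) (Matrix.replicateCol Unit (ε • b))
        (Δ + ε • (M v).toBlocks₂₂)).det := by
    intro v a b ha hb ε ν hν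
    have h := hH (ε • v) ν hν
    rw [map_smul, eq_fromBlocks_of_col (hMs v) ha hb, hA₀, fromBlocks_add_smul_add_smul,
      fromBlocks_add_smul, mul_zero, add_zero, smul_zero, add_zero] at h
    exact h
  -- a generic `ν₀`
  have hq0 : (Δ.map Polynomial.C + (Polynomial.X : k[X]) • E.map Polynomial.C).det ≠ 0 := by
    intro h
    have h0 := coeff_detLine_zero Δ E
    rw [h, Polynomial.coeff_zero] at h0
    exact hΔ0 h0.symm
  obtain ⟨ν₀, hν₀⟩ := Infinite.exists_notMem_finset
    ((Δ.map Polynomial.C + (Polynomial.X : k[X]) • E.map Polynomial.C).det.roots.toFinset ∪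
      {0, -1})
  simp only [Finset.mem_union, Multiset.mem_toFinset, Polynomial.mem_roots hq0,
    Polynomial.IsRoot.def, eval_detLine, Finset.mem_insert, Finset.mem_singleton, not_or] at hν₀
  obtain ⟨hΔ'0, hν00, hν01⟩ := hν₀
  set Δ' : Matrix ι' ι' k := Δ + ν₀ • E with hΔ'
  have hΔ'u : IsUnit Δ'.det := isUnit_iff_ne_zero.2 hΔ'0
  -- `tr (((Δ')⁻¹ - Δ⁻¹) (C - b bᵀ)) = 0` along every direction with corner `1`
  have hS2 : ∀ (v : V) (b : ι' → k), M v (Sum.inl ()) (Sum.inl ()) = 1 →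
      (∀ i, M v (Sum.inr i) (Sum.inl ()) = b i) →
      ((Δ'⁻¹ - Δ⁻¹) * ((M v).toBlocks₂₂ - Matrix.vecMulVec b b)).trace = 0 := by
    intro v b hva hvb
    set C : Matrix ι' ι' k := (M v).toBlocks₂₂ with hC
    set N₂ : Matrix ι' ι' k := C - Matrix.vecMulVec b b with hN₂
    have key : ∀ ε : k, ε ∉ ({0} : Finset k) →
        (Δ' + ε • N₂).det = (1 + ν₀) ^ j * (1 + 0 * ε) ^ j * (Δ + ε • N₂).det := by
      intro ε hε
      simp only [Finset.mem_singleton] at hε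
      have h := hHdir v 1 b hva hvb ε ν₀ hν01
      rw [mul_one, det_fromBlocks_corner hε, det_fromBlocks_corner hε,
        inv_smul_vecMulVec_smul hε] at h
      have hm1 : Δ + ε • C + ν₀ • E - ε • Matrix.vecMulVec b b = Δ' + ε • N₂ := by
        rw [hΔ', hN₂, smul_sub]; abel
      have hm2 : Δ + ε • C - ε • Matrix.vecMulVec b b = Δ + ε • N₂ := by
        rw [hN₂, smul_sub]; abel
      rw [hm1, hm2, ← mul_assoc, mul_comm ((1 + ν₀) ^ j) ε, mul_assoc] at h
      rw [zero_mul, add_zero, one_pow, mul_one]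
      exact mul_left_cancel₀ hε h
    obtain ⟨h0, h1⟩ := coeff_eq_of_det_add_smul_eq _ key
    rw [coeff_detLine_one hΔ'u, coeff_detLine_one hΔ, mul_zero, zero_mul, zero_add,
      ← mul_assoc, ← h0] at h1
    have h2 : (Δ'⁻¹ * N₂).trace = (Δ⁻¹ * N₂).trace := mul_left_cancel₀ hΔ'0 h1
    rw [Matrix.sub_mul, Matrix.trace_sub, h2, sub_self]
  -- the quadratic form of `N := (Δ')⁻¹ - Δ⁻¹` vanishes on the hyperplane `l ⬝ b = 0`
  have hquad : ∀ b : ι' → k, l ⬝ᵥ b = 0 → b ⬝ᵥ (Δ'⁻¹ - Δ⁻¹) *ᵥ b = 0 := by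
    intro b hb
    obtain ⟨v₁, h1a⟩ := h1
    set b₁ : ι' → k := fun i => M v₁ (Sum.inr i) (Sum.inl ()) with hb₁
    obtain ⟨u, hua, hub⟩ := h0 b hb
    have g : ∀ c : k, ((Δ'⁻¹ - Δ⁻¹) * ((M v₁).toBlocks₂₂ + c • (M u).toBlocks₂₂ -
        (Matrix.vecMulVec b₁ b₁ + c • (Matrix.vecMulVec b₁ b + Matrix.vecMulVec b b₁) +
          c ^ 2 • Matrix.vecMulVec b b))).trace = 0 := by
      intro c
      have h := hS2 (v₁ + c • u) (b₁ + c • b) (by simp [h1a, hua])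
        (fun i => by simp [hb₁, hub])
      have hT : (M (v₁ + c • u)).toBlocks₂₂ = (M v₁).toBlocks₂₂ + c • (M u).toBlocks₂₂ := by
        ext i j
        simp [Matrix.toBlocks₂₂]
      have hV : Matrix.vecMulVec (b₁ + c • b) (b₁ + c • b) =
          Matrix.vecMulVec b₁ b₁ + c • (Matrix.vecMulVec b₁ b + Matrix.vecMulVec b b₁) +
            c ^ 2 • Matrix.vecMulVec b b := by
        rw [Matrix.add_vecMulVec, Matrix.vecMulVec_add, Matrix.vecMulVec_add,
          Matrix.smul_vecMulVec, Matrix.vecMulVec_smul, Matrix.smul_vecMulVec,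
          Matrix.vecMulVec_smul, smul_smul, ← pow_two, smul_add]
        abel
      rwa [hT, hV] at h
    have g0 := g 0
    have g1 := g 1
    have g2 := g (-1)
    simp only [Matrix.mul_add, Matrix.mul_sub, Matrix.mul_smul, Matrix.trace_add,
      Matrix.trace_sub, Matrix.trace_smul, trace_mul_vecMulVec, smul_eq_mul] at g0 g1 g2
    have h3 : (2 : k) * ((Δ'⁻¹ - Δ⁻¹) *ᵥ b ⬝ᵥ b) = 0 := by
      linear_combination 2 * g0 - g1 - g2
    rw [dotProduct_comm]
    exact (mul_eq_zero.1 h3).resolve_left two_ne_zero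
  -- so `N` has rank `≤ 2`, and `ν₀ E = -Δ N Δ'`
  have hNs : (Δ'⁻¹ - Δ⁻¹)ᵀ = Δ'⁻¹ - Δ⁻¹ := by
    have hΔ's : Δ'ᵀ = Δ' := by rw [hΔ', Matrix.transpose_add, Matrix.transpose_smul, hΔs, hEs]
    rw [Matrix.transpose_sub, Matrix.transpose_nonsing_inv, Matrix.transpose_nonsing_inv, hΔ's,
      hΔs]
  have hNr := rank_le_two_of_quadratic_form_eq_zero_on_hyperplane hNs l hquad
  have hE : E = ((-ν₀⁻¹) • Δ) * (Δ'⁻¹ - Δ⁻¹) * Δ' := by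
    have h1 : Δ * (Δ'⁻¹ - Δ⁻¹) * Δ' = Δ - Δ' := by
      rw [Matrix.mul_sub, Matrix.sub_mul, Matrix.mul_nonsing_inv _ hΔ, Matrix.one_mul,
        Matrix.mul_assoc, Matrix.nonsing_inv_mul _ hΔ'u, Matrix.mul_one]
    rw [Matrix.smul_mul, Matrix.smul_mul, h1, hΔ', sub_add_cancel_left, smul_neg, smul_smul,
      neg_mul, inv_mul_cancel₀ hν00, neg_smul, one_smul, neg_neg]
  rw [hE]
  exact (Matrix.rank_mul_le_left _ _).trans ((Matrix.rank_mul_le_right _ _).trans hNr)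

end Core

end Summit.ValiantsHypothesis.ValiantsHypothesis.Theorems.SymPencilHomogeneousDropRankTwo

end
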